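import Summits.ValiantsHypothesis.ValiantsHypothesis.Theorems.SymPencilSdcPerThreeWindow
import Literature.LinearAlgebra.Matrix.PermanentSubperm

/-!
# Route `SymPencil` — `sdc(per₃) = 13`: an explicit symmetric affine determinantal representation
# of `per₃` of size `13` (`--supports` stmt-ValiantsHypothesis-5674 `SdcSuperquadratic`; calibration)

CALIBRATION (decides nothing about the crux `SdcSuperquadratic`, which quantifies over all large
`n`; nothing here bears on `VP ≠ VNP`).  The tree holds `13 ≤ sdc(per₃) ≤ 20`
(`SymPencilSdcPerThreeTen.thirteen_le_of_isSymm_isAffineDetRepr_perPoly_three` = the symmetric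
Alper–Bogart–Velasco bound; `SymPencilSdcPerThreeWindow.sdc_perPoly_three_window`, Quarez's
universal upper bound).  This file CLOSES that window from above: **`sdc(per₃) = 13`** over every
field with `2 ≠ 0` (so over `ℂ`), by the explicit `13 × 13` symmetric pencil ("bordered Schur
design")

  `A = [[0, (r, 0)ᵀ], [(r, 0), M]]`,  `M = [[0, 1₆], [1₆, S(v)]]`,
  `S(v) = ⅟2 · [[0, P(v)], [P(v), 0]]`, `P(v)_{ab} = v_c` (`{a, b, c} = {0, 1, 2}`), `P(v)_{aa} = 0`,

where `v = (x₀₀, x₀₁, x₀₂)` is row `0` of the variable matrix and `r ∈ K⁶` lists the six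
variables of rows `1, 2` (the "slots" `Fin 2 × Fin 3`).  The lower block `M` has `det M = 1` and
the POLYNOMIAL inverse `[[−S, 1], [1, 0]]`, so the Schur complement formula gives
`det A = det M · (0 − (r,0)ᵀ M⁻¹ (r,0)) = rᵀ S(v) r = Σ_{a ≠ b} v_c r_{1a} r_{2b} = per₃`
(Laplace expansion along row `0`).  The two block identities are proved for an ARBITRARY block
`S` (`det_bordered_fromBlocks`, `isSymm_bordered_fromBlocks`), since the companion file
`SymPencilSdcPerFourTwentyNine` reuses them one level deeper.

WHY THIS MATTERS FOR THE `n = 4` FRONTIER.  In the two-sided kernel package of a symmetric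
representation of `per_n` of size `m` (origin normal form `A₀ ≅ 0 ⊕ D`, border `b`, kernel rows
`B = im b` isotropic, `V = ker b ⊆ Sing Z(per_n)`), the representation above is exactly the
ONE-ROW LAGRANGIAN cell: `V = ker b` = row `0` (dimension `n`), `B` Lagrangian (`r = n² − n`,
defect `d = m − 1 − 2r = 0`), `m = 2(n² − n) + 1`.  At `n = 4` this cell is
`(r, dim V, d) = (12, 4, 0)` at `m = 25` — the one branch of the rung `sdc(per₄) ≥ 26` that no
Hessian / `e₂` lever can exclude (crux note `Cruxes/SdcPerBeyondN/NEXT-RUNG.md` (G)).  So the cell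
is GENUINELY INHABITED at `n = 3`.

Main declarations: `fromBlocks_zero_one_one_mul`, `det_fromBlocks_zero_one_one`,
`det_bordered_fromBlocks`, `isSymm_bordered_fromBlocks` (general block identities);
`hasSymmDetRepr_perPoly_three_thirteen` (any commutative ring with `⅟2`);
`sdc_perPoly_three_le_thirteen`, `sdc_perPoly_three_eq_thirteen` (fields with `2 ≠ 0`),
`sdc_perPoly_three_eq_thirteen_complex`.
-/

noncomputable section

-- single-conjunct layout: Sub = Summit, duplicated namespace component intended
set_option linter.dupNamespace false

namespace Summit.ValiantsHypothesis.ValiantsHypothesis.Theorems.SymPencilSdcPerThreeThirteen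

open Matrix MvPolynomial
open Literature.Computability.AlgebraicComplexity
open Summit.ValiantsHypothesis.ValiantsHypothesis.Theorems.SymPencilSdcPerThreeWindow

/-! ### General block identities of the bordered Schur design -/

section Blocks

variable {ι P : Type*} [Fintype ι] [DecidableEq ι] [CommRing P]

/-- `[[0, 1], [1, S]] · [[−S, 1], [1, 0]] = 1`: the block `M = [[0, 1], [1, S]]` has a POLYNOMIAL
inverse, whatever `S` is. [folklore] -/
theorem fromBlocks_zero_one_one_mul (S : Matrix ι ι P) :
    Matrix.fromBlocks (0 : Matrix ι ι P) 1 1 S * Matrix.fromBlocks (-S) 1 1 0 = 1 := by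
  simp [Matrix.fromBlocks_multiply]

/-- `det [[0, 1], [1, S]] = (−1)^{|ι|}`: left-multiplying by the unipotent `[[1, 1], [0, 1]]` gives
`[[1, 1 + S], [1, S]]`, of determinant `det (S − (1 + S)) = det (−1)`. [folklore] -/
theorem det_fromBlocks_zero_one_one (S : Matrix ι ι P) :
    (Matrix.fromBlocks (0 : Matrix ι ι P) 1 1 S).det = (-1) ^ Fintype.card ι := by
  set U : Matrix (ι ⊕ ι) (ι ⊕ ι) P := Matrix.fromBlocks (1 : Matrix ι ι P) (1 : Matrix ι ι P)
    (0 : Matrix ι ι P) (1 : Matrix ι ι P) with hU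
  have hmul : U * Matrix.fromBlocks (0 : Matrix ι ι P) 1 1 S = Matrix.fromBlocks 1 (1 + S) 1 S := by
    simp [hU, Matrix.fromBlocks_multiply]
  have h1 : U.det = 1 := by
    rw [hU, Matrix.det_fromBlocks_zero₂₁, det_one, one_mul]
  have h2 : (Matrix.fromBlocks 1 (1 + S) 1 S).det = (-1) ^ Fintype.card ι := by
    rw [Matrix.det_fromBlocks_one₁₁, Matrix.one_mul, sub_add_cancel_right, det_neg, det_one, mul_one]
  have h := congrArg Matrix.det hmul
  rwa [det_mul, h1, one_mul, h2] at h

omit [DecidableEq ι] in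
/-- `vᵀ N v` as an explicit double sum: the `() ()` entry of
`replicateRow v * N * replicateCol v`. [folklore] -/
theorem replicateRow_mul_mul_replicateCol (v : ι → P) (N : Matrix ι ι P) :
    (replicateRow Unit v * N * replicateCol Unit v) () () = ∑ i, ∑ j, v i * N i j * v j := by
  simp only [Matrix.mul_apply, Matrix.replicateRow_apply, Matrix.replicateCol_apply,
    Finset.sum_mul]
  rw [Finset.sum_comm]

/-- **Determinant of the bordered Schur design.**  For any vector `v` and any square block `S`,
`det [[0, (v,0)ᵀ], [(v,0), [[0, 1], [1, S]]]] = (−1)^{|ι|} · Σ_{i,j} v_i S_{ij} v_j`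
(Schur complement at the invertible lower block, whose inverse is `[[−S, 1], [1, 0]]`). [folklore] -/
theorem det_bordered_fromBlocks (v : ι → P) (S : Matrix ι ι P) :
    (Matrix.fromBlocks (0 : Matrix Unit Unit P) (replicateRow Unit (Sum.elim v 0))
        (replicateCol Unit (Sum.elim v 0)) (Matrix.fromBlocks (0 : Matrix ι ι P) 1 1 S)).det =
      (-1) ^ Fintype.card ι * ∑ i, ∑ j, v i * S i j * v j := by
  letI : Invertible (Matrix.fromBlocks (0 : Matrix ι ι P) 1 1 S) :=
    invertibleOfRightInverse _ _ (fromBlocks_zero_one_one_mul S)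
  have hinv : ⅟(Matrix.fromBlocks (0 : Matrix ι ι P) 1 1 S) = Matrix.fromBlocks (-S) 1 1 0 :=
    invOf_eq_right_inv (fromBlocks_zero_one_one_mul S)
  rw [Matrix.det_fromBlocks₂₂, det_fromBlocks_zero_one_one, hinv, det_unique, Matrix.sub_apply,
    Matrix.zero_apply, zero_sub, PUnit.default_eq_unit, replicateRow_mul_mul_replicateCol]
  simp only [Fintype.sum_sum_type, Sum.elim_inl, Sum.elim_inr, Matrix.fromBlocks_apply₁₁,
    Matrix.fromBlocks_apply₂₁, Matrix.neg_apply, Pi.zero_apply, mul_zero, zero_mul, add_zero,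
    Finset.sum_const_zero, mul_neg, neg_mul, Finset.sum_neg_distrib, neg_neg]

omit [Fintype ι] in
/-- The bordered Schur design is symmetric as soon as `S` is. [folklore] -/
theorem isSymm_bordered_fromBlocks (v : ι → P) {S : Matrix ι ι P} (hS : S.IsSymm) :
    (Matrix.fromBlocks (0 : Matrix Unit Unit P) (replicateRow Unit (Sum.elim v 0))
        (replicateCol Unit (Sum.elim v 0)) (Matrix.fromBlocks (0 : Matrix ι ι P) 1 1 S)).IsSymm := by
  refine Matrix.IsSymm.fromBlocks (by simp [Matrix.IsSymm]) (transpose_replicateRow _) ?_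
  exact Matrix.IsSymm.fromBlocks (by simp [Matrix.IsSymm]) transpose_one hS

omit [Fintype ι] in
/-- Entries of the bordered Schur design have total degree `≤ 1` as soon as those of `v` and `S`
do (the other entries are `0` and `1`). [folklore] -/
theorem totalDegree_bordered_fromBlocks_le {σ R : Type*} [CommRing R]
    (v : ι → MvPolynomial σ R) (S : Matrix ι ι (MvPolynomial σ R))
    (hv : ∀ i, (v i).totalDegree ≤ 1) (hS : ∀ i j, (S i j).totalDegree ≤ 1)
    (a b : Unit ⊕ (ι ⊕ ι)) :
    (Matrix.fromBlocks (0 : Matrix Unit Unit (MvPolynomial σ R)) (replicateRow Unit (Sum.elim v 0))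
        (replicateCol Unit (Sum.elim v 0))
        (Matrix.fromBlocks (0 : Matrix ι ι (MvPolynomial σ R)) 1 1 S) a b).totalDegree ≤ 1 := by
  rcases a with ⟨⟩ | (p | p) <;> rcases b with ⟨⟩ | (q | q)
  · simp
  · simpa using hv q
  · simp
  · simpa using hv p
  · simp
  · simp only [Matrix.fromBlocks_apply₂₂, Matrix.fromBlocks_apply₁₂, Matrix.one_apply]
    split_ifs <;> simp
  · simp
  · simp only [Matrix.fromBlocks_apply₂₂, Matrix.fromBlocks_apply₂₁, Matrix.one_apply]
    split_ifs <;> simp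
  · simpa using hS p q

end Blocks

/-! ### The `13 × 13` pencil for `per₃` -/

/-- `|Unit ⊕ ((Fin 2 × Fin 3) ⊕ (Fin 2 × Fin 3))| = 13`. [folklore] -/
theorem card_index_thirteen : Fintype.card (Unit ⊕ ((Fin 2 × Fin 3) ⊕ (Fin 2 × Fin 3))) = 13 := by
  simp [Fintype.card_sum, Fintype.card_prod]

/-- The quadratic form of the pairing block `S(v) = ⅟2·[[0, P(v)], [P(v), 0]]` on the border
`r = (x_{a+1,c})` is `per₃`: `Σ_{p,q} r_p S(v)_{pq} r_q = per₃`. [folklore] -/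
theorem sum_border_pairing_border (R : Type*) [CommRing R] [Invertible (2 : R)] :
    ∑ p : Fin 2 × Fin 3, ∑ q : Fin 2 × Fin 3,
      (X (p.1.succ, p.2) : MvPolynomial (Fin 3 × Fin 3) R) *
        (if p.1 ≠ q.1 ∧ p.2 ≠ q.2 then C (⅟2 : R) * X (0, -(p.2 + q.2)) else 0) *
        X (q.1.succ, q.2) = perPoly (Fin 3) R := by
  have h2 : (2 : MvPolynomial (Fin 3 × Fin 3) R) * C (⅟2 : R) = 1 := by
    rw [← map_ofNat C 2, ← map_mul, mul_invOf_self, map_one]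
  have e1 : (-1 : Fin 3) = 2 := by decide
  have e2 : (-2 : Fin 3) = 1 := by decide
  rw [perPoly, Matrix.permanent_fin_three_row]
  simp only [Matrix.mvPolynomialX_apply, Fintype.sum_prod_type, Fin.sum_univ_two,
    Fin.sum_univ_three, Fin.isValue]
  simp only [ne_eq, not_true_eq_false, and_false, and_true, if_false, if_true, Fin.reduceEq,
    not_false_eq_true, mul_zero, zero_mul, add_zero, zero_add, Fin.succ_zero_eq_one,
    Fin.succ_one_eq_two, Fin.reduceAdd, neg_zero, e1, e2]
  linear_combination (X (0, 0) * (X (1, 1) * X (2, 2) + X (1, 2) * X (2, 1)) +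
      X (0, 1) * (X (1, 0) * X (2, 2) + X (1, 2) * X (2, 0)) +
      X (0, 2) * (X (1, 0) * X (2, 1) + X (1, 1) * X (2, 0)) :
        MvPolynomial (Fin 3 × Fin 3) R) * h2

/-- **`per₃` has a symmetric affine determinantal representation of size `13`** over every
commutative ring in which `2` is invertible: the bordered Schur design on the border
`r = (x_{a+1,c})_{(a,c) ∈ Fin 2 × Fin 3}` with pairing block `S(v) = ⅟2·[[0, P(v)], [P(v), 0]]`,
reindexed along `Unit ⊕ ((Fin 2 × Fin 3) ⊕ (Fin 2 × Fin 3)) ≃ Fin 13`. [folklore] -/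
theorem hasSymmDetRepr_perPoly_three_thirteen (R : Type*) [CommRing R] [Invertible (2 : R)] :
    HasSymmDetRepr (perPoly (Fin 3) R) 13 := by
  -- the data
  obtain ⟨v, hv⟩ : ∃ v : Fin 2 × Fin 3 → MvPolynomial (Fin 3 × Fin 3) R,
      v = fun p => X (p.1.succ, p.2) := ⟨_, rfl⟩
  obtain ⟨S, hS⟩ : ∃ S : Matrix (Fin 2 × Fin 3) (Fin 2 × Fin 3) (MvPolynomial (Fin 3 × Fin 3) R),
      S = Matrix.of fun p q =>
        if p.1 ≠ q.1 ∧ p.2 ≠ q.2 then C (⅟2 : R) * X (0, -(p.2 + q.2)) else 0 := ⟨_, rfl⟩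
  let A : Matrix (Unit ⊕ ((Fin 2 × Fin 3) ⊕ (Fin 2 × Fin 3)))
      (Unit ⊕ ((Fin 2 × Fin 3) ⊕ (Fin 2 × Fin 3))) (MvPolynomial (Fin 3 × Fin 3) R) :=
    Matrix.fromBlocks 0 (replicateRow Unit (Sum.elim v 0)) (replicateCol Unit (Sum.elim v 0))
      (Matrix.fromBlocks 0 1 1 S)
  let e : Unit ⊕ ((Fin 2 × Fin 3) ⊕ (Fin 2 × Fin 3)) ≃ Fin 13 :=
    Fintype.equivFinOfCardEq card_index_thirteen
  -- symmetry of the pairing block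
  have hSsymm : S.IsSymm := by
    refine Matrix.IsSymm.ext fun p q => ?_
    rw [hS, Matrix.of_apply, Matrix.of_apply, add_comm q.2 p.2]
    by_cases h : p.1 ≠ q.1 ∧ p.2 ≠ q.2
    · rw [if_pos h, if_pos ⟨Ne.symm h.1, Ne.symm h.2⟩]
    · have h' : ¬ (q.1 ≠ p.1 ∧ q.2 ≠ p.2) := fun hq => h ⟨Ne.symm hq.1, Ne.symm hq.2⟩
      rw [if_neg h, if_neg h']
  -- degrees
  have hX : ∀ s : Fin 3 × Fin 3, (X s : MvPolynomial (Fin 3 × Fin 3) R).totalDegree ≤ 1 :=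
    fun s => (isHomogeneous_X R s).totalDegree_le
  have hvdeg : ∀ i, (v i).totalDegree ≤ 1 := fun i => by rw [hv]; exact hX _
  have hSdeg : ∀ i j, (S i j).totalDegree ≤ 1 := fun i j => by
    rw [hS, Matrix.of_apply]
    split_ifs
    · exact (totalDegree_mul _ _).trans (by simpa using hX _)
    · simp
  refine ⟨Matrix.reindex e e A, (isSymm_bordered_fromBlocks v hSsymm).submatrix _, ?_, ?_⟩
  · intro i j
    simpa only [Matrix.reindex_apply, Matrix.submatrix_apply] using
      totalDegree_bordered_fromBlocks_le v S hvdeg hSdeg (e.symm i) (e.symm j)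
  · rw [Matrix.det_reindex_self, det_bordered_fromBlocks, ← sum_border_pairing_border R, hv, hS]
    simp only [Fintype.card_prod, Fintype.card_fin, Matrix.of_apply]
    norm_num

/-- **`sdc(per₃) ≤ 13`** over any field with `2 ≠ 0`. [folklore] -/
theorem sdc_perPoly_three_le_thirteen (K : Type*) [Field K] (h2 : (2 : K) ≠ 0) :
    symmDeterminantalComplexity (perPoly (Fin 3) K) ≤ 13 := by
  letI : Invertible (2 : K) := invertibleOfNonzero h2
  exact symmDeterminantalComplexity_le (hasSymmDetRepr_perPoly_three_thirteen K)

/-- **`sdc(per₃) = 13`** over any field with `2 ≠ 0`: the explicit pencil meets the tree's symmetric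
Alper–Bogart–Velasco lower bound `13 ≤ sdc(per₃)`
(`SymPencilSdcPerThreeWindow.sdc_perPoly_three_window`). [folklore] -/
theorem sdc_perPoly_three_eq_thirteen (K : Type*) [Field K] (h2 : (2 : K) ≠ 0) :
    symmDeterminantalComplexity (perPoly (Fin 3) K) = 13 :=
  le_antisymm (sdc_perPoly_three_le_thirteen K h2) (sdc_perPoly_three_window K h2).1

/-- The complex instance: **`sdc(per₃) = 13` over `ℂ`**. [folklore] -/
theorem sdc_perPoly_three_eq_thirteen_complex :
    symmDeterminantalComplexity (perPoly (Fin 3) ℂ) = 13 :=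
  sdc_perPoly_three_eq_thirteen ℂ two_ne_zero

end Summit.ValiantsHypothesis.ValiantsHypothesis.Theorems.SymPencilSdcPerThreeThirteen

end
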